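import Mathlib
import Summits.CriticalPhenomena.PercolationContinuityZ3.Theorems.PercNearOneGluingNoHeavyLowerTailMomentRatioTNBeta
import HarnessLib

/-!
# Terminating Gauss sums `₂F₁(a, -r; c; g)`: contiguous identities, positivity, complete monotonicity in `r`

Support file for the Sahi / Conjecture-P programme of route `PercNearOneGluingNoHeavy`
(`--supports stmt-CriticalPhenomena-4575`, prover prim-l12-p5 gen 36; proof note
`prim-l12-p5/PROOF-THEOREM-H-g36.md` §3).  No definitions, no named facts, no sorries.

Throughout, `g : ℝ` is fixed and `H : ℝ → ℝ → ℕ → ℝ` is ANY function satisfying the defining hypothesis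
`hH : H a c r = Σ_{k ≤ r} C(r,k) (-g)^k (∏_{i<k} (a+i)) / (∏_{i<k} (c+i))`, i.e. `H a c r = ₂F₁(a, -r; c; g)`
(a finite sum; instantiate with the lambda and `fun _ _ _ => rfl`).  We prove, for `c > 0`:

* `hyp_step` (b-step, memo (3.1)): `c · (H a c (r+1) - H a c r) = -(a g) · H (a+1) (c+1) r`;
* `hyp_csplit` (memo (3.2)): `c · H a c r = (c - a) · H a (c+1) r + a · H (a+1) (c+1) r`;
* `hyp_posrec` (memo (3.3)): `c · H a c (r+1) = c (1-g) H a c r + g (c-a) H a (c+1) r`, hence `hyp_pos`: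
  `0 ≤ g < 1`, `a ≤ c` ⟹ `H a c r > 0` (the Beta mixture `E[(1-gT)^r]`, `T ~ Beta(a, c-a)`, when `0 < a < c`);
* `hyp_altSum` (memo (3.4)): the Hausdorff differences in `r` are
  `D_k (H a c ·)(j) = (∏_{i<k}(a+i)) g^k / (∏_{i<k}(c+i)) · H (a+k) (c+k) j`, nonnegative for `0 ≤ a ≤ c`;
* `hyp_gauss` (memo (3.5), Gauss' contiguous relation in the first parameter, DLMF 15.5.11 at `b = -r`):
  `(c - a) H (a-1) c r + (2a - c - (r + a) g) H a c r - a (1 - g) H (a+1) c r = 0`.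
-/

namespace Summit.CriticalPhenomena.PercolationContinuityZ3.Theorems

namespace HypergeomCM

open Finset
open scoped Nat

/-- Pochhammer shift: `∏_{i<k+1} (x+i) = x · ∏_{i<k} (x+1+i)`. -/
theorem prod_succ_shift (x : ℝ) (k : ℕ) :
    ∏ i ∈ range (k + 1), (x + i) = x * ∏ i ∈ range k, (x + 1 + i) := by
  rw [prod_range_succ' (fun i => x + (i : ℝ)), mul_comm]
  simp only [Nat.cast_add, Nat.cast_one, Nat.cast_zero, add_zero]
  congr 1
  exact prod_congr rfl fun i _ => by ring

/-- Positivity of the Pochhammer products for `x > 0`. -/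
theorem prod_pos_of_pos (x : ℝ) (hx : 0 < x) (k : ℕ) : 0 < ∏ i ∈ range k, (x + i) :=
  prod_pos fun i _ => by positivity

section

variable (g : ℝ) (H : ℝ → ℝ → ℕ → ℝ)
  (hH : ∀ a c r, H a c r = ∑ k ∈ range (r + 1), (r.choose k : ℝ) * (-g) ^ k *
    ((∏ i ∈ range k, (a + i)) / (∏ i ∈ range k, (c + i))))
include hH

/-- `H a c 0 = 1`. -/
theorem hyp_zero (a c : ℝ) : H a c 0 = 1 := by
  rw [hH]
  simp

/-- **b-step** (memo (3.1)): `c · (H a c (r+1) - H a c r) = -(a g) · H (a+1) (c+1) r`  (`c > 0`). -/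
theorem hyp_step (a c : ℝ) (hc : 0 < c) (r : ℕ) :
    c * (H a c (r + 1) - H a c r) = -(a * g) * H (a + 1) (c + 1) r := by
  have hc0 : c ≠ 0 := hc.ne'
  -- termwise identity
  have key : ∀ k : ℕ, c * ((-g) ^ (k + 1) * ((∏ i ∈ range (k + 1), (a + i)) / ∏ i ∈ range (k + 1), (c + i))) =
      -(a * g) * ((-g) ^ k * ((∏ i ∈ range k, (a + 1 + i)) / ∏ i ∈ range k, (c + 1 + i))) := by
    intro k
    rw [prod_succ_shift a k, prod_succ_shift c k, pow_succ]
    have hc' : (∏ i ∈ range k, (c + 1 + (i : ℝ))) ≠ 0 := (prod_pos_of_pos (c + 1) (by linarith) k).ne'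
    field_simp
  -- Pascal on the (r+1)-sum
  have hsplit : H a c (r + 1) = 1 + ∑ k ∈ range (r + 1), ((r.choose k : ℝ) + (r.choose (k + 1) : ℝ)) *
      (-g) ^ (k + 1) * ((∏ i ∈ range (k + 1), (a + i)) / ∏ i ∈ range (k + 1), (c + i)) := by
    rw [hH a c (r + 1), sum_range_succ']
    simp only [Nat.choose_succ_succ', Nat.cast_add, Nat.choose_zero_right, Nat.cast_one, pow_zero,
      prod_range_zero, div_one, mul_one]
    ring
  have hsplit' : H a c r = 1 + ∑ k ∈ range (r + 1), (r.choose (k + 1) : ℝ) *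
      (-g) ^ (k + 1) * ((∏ i ∈ range (k + 1), (a + i)) / ∏ i ∈ range (k + 1), (c + i)) := by
    rw [hH a c r, sum_range_succ',
      sum_range_succ (fun k => (r.choose (k + 1) : ℝ) *
        (-g) ^ (k + 1) * ((∏ i ∈ range (k + 1), (a + i)) / ∏ i ∈ range (k + 1), (c + i))) r,
      Nat.choose_eq_zero_of_lt (by omega : r < r + 1)]
    simp only [Nat.cast_zero, zero_mul, add_zero, Nat.choose_zero_right, Nat.cast_one, pow_zero,
      prod_range_zero, div_one, mul_one]
    ring
  rw [hsplit, hsplit', hH (a + 1) (c + 1) r, add_sub_add_left_eq_sub, ← sum_sub_distrib, mul_sum, mul_sum]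
  refine sum_congr rfl fun k _ => ?_
  linear_combination (r.choose k : ℝ) * key k

/-- **c-split** (memo (3.2)): `c · H a c r = (c-a) · H a (c+1) r + a · H (a+1) (c+1) r`  (`c > 0`). -/
theorem hyp_csplit (a c : ℝ) (hc : 0 < c) (r : ℕ) :
    c * H a c r = (c - a) * H a (c + 1) r + a * H (a + 1) (c + 1) r := by
  have hc0 : c ≠ 0 := hc.ne'
  rw [hH a c r, hH a (c + 1) r, hH (a + 1) (c + 1) r, mul_sum, mul_sum, mul_sum, ← sum_add_distrib]
  refine sum_congr rfl fun k _ => ?_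
  have h1 : a * ∏ i ∈ range k, (a + 1 + (i : ℝ)) = (∏ i ∈ range k, (a + i)) * (a + k) := by
    rw [← prod_succ_shift a k, prod_range_succ]
  have h2 : c * ∏ i ∈ range k, (c + 1 + (i : ℝ)) = (∏ i ∈ range k, (c + i)) * (c + k) := by
    rw [← prod_succ_shift c k, prod_range_succ]
  have hPc : (∏ i ∈ range k, (c + (i : ℝ))) ≠ 0 := (prod_pos_of_pos c hc k).ne'
  have hPc1 : (∏ i ∈ range k, (c + 1 + (i : ℝ))) ≠ 0 := (prod_pos_of_pos (c + 1) (by linarith) k).ne'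
  have hck : c + (k : ℝ) ≠ 0 := by positivity
  have q1 : (∏ i ∈ range k, (a + (i : ℝ))) / ∏ i ∈ range k, (c + (i : ℝ)) =
      (∏ i ∈ range k, (a + (i : ℝ))) * (c + k) / (c * ∏ i ∈ range k, (c + 1 + (i : ℝ))) := by
    rw [div_eq_div_iff hPc (mul_ne_zero hc0 hPc1)]
    linear_combination (∏ i ∈ range k, (a + (i : ℝ))) * h2
  have q2 : a * ((r.choose k : ℝ) * (-g) ^ k *
      ((∏ i ∈ range k, (a + 1 + (i : ℝ))) / ∏ i ∈ range k, (c + 1 + (i : ℝ)))) =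
      (r.choose k : ℝ) * (-g) ^ k * ((∏ i ∈ range k, (a + (i : ℝ))) * (a + k) /
        ∏ i ∈ range k, (c + 1 + (i : ℝ))) := by
    rw [← h1]
    ring
  rw [q1, q2]
  field_simp
  ring

/-- **positive recurrence** (memo (3.3)): `c · H a c (r+1) = c (1-g) H a c r + g (c-a) H a (c+1) r`  (`c > 0`). -/
theorem hyp_posrec (a c : ℝ) (hc : 0 < c) (r : ℕ) :
    c * H a c (r + 1) = c * (1 - g) * H a c r + g * (c - a) * H a (c + 1) r := by
  linear_combination hyp_step g H hH a c hc r + g * hyp_csplit g H hH a c hc r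

/-- **Positivity**: for `0 ≤ g < 1`, `c > 0`, `a ≤ c`: `H a c r > 0` for every `r`. -/
theorem hyp_pos (hg0 : 0 ≤ g) (hg1 : g < 1) (a : ℝ) :
    ∀ (r : ℕ) (c : ℝ), 0 < c → a ≤ c → 0 < H a c r := by
  intro r
  induction r with
  | zero => intro c _ _; rw [hyp_zero g H hH]; exact one_pos
  | succ r ih =>
    intro c hc hac
    have key := hyp_posrec g H hH a c hc r
    have h1 : 0 < c * (1 - g) * H a c r := mul_pos (mul_pos hc (by linarith)) (ih c hc hac)
    have h2 : 0 ≤ g * (c - a) * H a (c + 1) r :=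
      mul_nonneg (mul_nonneg hg0 (by linarith)) (ih (c + 1) (by linarith) (by linarith)).le
    have h3 : 0 < c * H a c (r + 1) := by rw [key]; linarith
    nlinarith

/-- **Hausdorff differences in `r`** (memo (3.4)):
`D_k (H a c ·)(j) = (∏_{i<k}(a+i)) g^k/(∏_{i<k}(c+i)) · H (a+k) (c+k) j`  (`c > 0`). -/
theorem hyp_altSum (a c : ℝ) (hc : 0 < c) (k : ℕ) : ∀ j : ℕ,
    ∑ i ∈ range (k + 1), (-1 : ℝ) ^ i * (k.choose i : ℝ) * H a c (j + i) =
      (∏ i ∈ range k, (a + i)) * g ^ k / (∏ i ∈ range k, (c + i)) * H (a + k) (c + k) j := by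
  induction k with
  | zero => intro j; simp
  | succ k ih =>
    intro j
    rw [MomentRatioTN.altSum_succ' (fun r => H a c r) k j, ih j, ih (j + 1)]
    have hstep := hyp_step g H hH (a + k) (c + k) (by positivity) j
    have hPc : (∏ i ∈ range k, (c + (i : ℝ))) ≠ 0 := (prod_pos_of_pos c hc k).ne'
    have hck : (c + (k : ℝ)) ≠ 0 := by positivity
    have hdiff : H (a + k) (c + k) j - H (a + k) (c + k) (j + 1) =
        (a + k) * g / (c + k) * H (a + k + 1) (c + k + 1) j := by
      field_simp
      linear_combination -hstep
    rw [prod_range_succ, prod_range_succ, pow_succ, ← mul_sub, hdiff]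
    push_cast
    rw [show a + ((k : ℝ) + 1) = a + k + 1 by ring, show c + ((k : ℝ) + 1) = c + k + 1 by ring]
    field_simp

/-- For `0 ≤ a ≤ c`, `c > 0`, `0 ≤ g < 1` the sequence `r ↦ H a c r` is completely monotone. -/
theorem hyp_altSum_nonneg (hg0 : 0 ≤ g) (hg1 : g < 1) (a c : ℝ) (ha : 0 ≤ a) (hac : a ≤ c) (hc : 0 < c)
    (k j : ℕ) : 0 ≤ ∑ i ∈ range (k + 1), (-1 : ℝ) ^ i * (k.choose i : ℝ) * H a c (j + i) := by
  rw [hyp_altSum g H hH a c hc k j]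
  have h1 : 0 ≤ ∏ i ∈ range k, (a + (i : ℝ)) := prod_nonneg fun i _ => by positivity
  have h2 : 0 < ∏ i ∈ range k, (c + (i : ℝ)) := prod_pos_of_pos c hc k
  have h3 : 0 < H (a + k) (c + k) j := hyp_pos g H hH hg0 hg1 (a + k) j (c + k) (by positivity) (by linarith)
  positivity

/-- **Gauss' contiguous relation** in the first parameter for the terminating series (memo (3.5); DLMF 15.5.11
with `b = -r`, `z = g`): `(c-a) H (a-1) c r + (2a - c - (r+a) g) H a c r - a (1-g) H (a+1) c r = 0`  (`c > 0`). -/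
theorem hyp_gauss : ∀ (r : ℕ) (a c : ℝ), 0 < c →
    (c - a) * H (a - 1) c r + (2 * a - c - ((r : ℝ) + a) * g) * H a c r - a * (1 - g) * H (a + 1) c r = 0 := by
  intro r
  induction r with
  | zero =>
    intro a c _
    rw [hyp_zero g H hH, hyp_zero g H hH, hyp_zero g H hH]
    push_cast
    ring
  | succ r ih =>
    intro a c hc
    have e1 := hyp_step g H hH (a - 1) c hc r
    have e2 := hyp_step g H hH a c hc r
    have e3 := hyp_step g H hH (a + 1) c hc r
    rw [sub_add_cancel] at e1
    have ih' := ih (a + 1) (c + 1) (by linarith)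
    rw [add_sub_cancel_right] at ih'
    have ih0 := ih a c hc
    have sp := hyp_csplit g H hH a c hc r
    have hc' : c ≠ 0 := hc.ne'
    push_cast
    -- c · G(a,c,r+1) = (c-a) e1 + (…) e2 - a(1-g) e3 + c·G(a,c,r) - g a G(a+1,c+1,r) - g·[c-split]
    have key : c * ((c - a) * H (a - 1) c (r + 1) + (2 * a - c - ((r : ℝ) + 1 + a) * g) * H a c (r + 1) -
        a * (1 - g) * H (a + 1) c (r + 1)) = 0 := by
      linear_combination (c - a) * e1 + (2 * a - c - ((r : ℝ) + 1 + a) * g) * e2 - a * (1 - g) * e3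
        + c * ih0 - g * a * ih' - g * sp
    rcases mul_eq_zero.1 key with h | h
    · exact absurd h hc'
    · exact h

end

end HypergeomCM

end Summit.CriticalPhenomena.PercolationContinuityZ3.Theorems
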